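import Summits.AtomisticToContinuum.Crystallization.Theorems.HullExactificationCascadeRobustBarlowTemplateTransportVComm2A

/-!
# Line `registered` (crux `RobustBarlowTemplate`, stmt-AtomisticToContinuum-12088): commutation of `V⁻¹` with `I` and `J` (part 2/3, second half: the second direction)

Helper lemmas for `develop_transport` (the geometric half of the development): frames
`⟨x, t₁, t₂, U⟩` read in the scale-relative integer charts `IsZChart` of an everywhere-good
configuration, their transports and the coherence of the resulting development `frameAt`.  The
only metric inputs are the chart transfer lemma `develop_transfer` and `bond_nb_iff`; everything
else is label combinatorics in `ℤ³` (pattern facts `TransportPatterns*` of the sibling crux 9227,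
imported verbatim).  All `[folklore]` (HalesDSP2012 §1.3 for the two kissing patterns).

PORT of `PalmUnimodularRigidityShellsToBarlowChartTransportVComm2.lean` of the closed sibling
crux `ShellsToBarlowChart` (stmt-9227) to the SCALE-RELATIVE shell relation `y ∈ shell S x` of
this crux (in place of the bond window `0 < dist x y ∧ dist x y ≤ 28/25`) and to the
five-argument charts `IsZChart S x P A nbr`; the port rules (conjunct paths,
`bond a b ↦ b ∈ shell S a`, the threaded symmetry hypothesis
`hsy : ∀ x ∈ S, ∀ y ∈ shell S x, x ∈ shell S y` replacing `bond_symm`, `zchart_transfer` /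
`zchart_sqNormInt_eq` replacing `sqNormInt_transfer` / `IsZChart.sqNormInt_eq`, the
`open … hiding …` line) are listed under "Port notes" in `…RobustBarlowTemplateTransportSteps1.lean`
(and its extensions in `…TransportSteps6.lean`, `…TransportAttach1.lean`, `…TransportVComm1.lean`).

## Port notes (this part: `TransportVComm2`, second half)
* SIZE: the source part has 377 lines; ported it exceeds the 400-line cap, so its first theorem
  `VinvStep_Istep_back` lives in `…TransportVComm2A` (imported) and this file keeps the name of
  the part with `VinvStep_Istep_side`; each half has a registered anchor;
* the signature of `VinvStep_Istep_side` is parallel to the source with `hsy` inserted right after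
  `hch`; the bond conjunct of its conclusion became the shell membership
  `(VinvStep Pc nb (Jstep Pc nb ⟨x, t₁, t₂, U⟩)).pt ∈ shell S (VinvStep Pc nb (Istep Pc nb ⟨x, t₁, t₂, U⟩)).pt`;
  the bonds inside the proof became shell memberships read off `nb_mem … |>.2` / `bond_nb_iff`
  exactly as in the source; otherwise the proof is the source proof verbatim up to the rules (no
  metric constant occurs in this part);
* the chart-agnostic `hregI_of_valid`, `hregJ_of_valid` (9227 `Comm1`) are used from the 9227
  module (visible through our `…TransportVComm1`); the chart-agnostic `VinvStep_swap'` of the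
  source part (frame form of the 9227 `VinvStep_swap`, no chart hypothesis) is NOT re-proved (the
  gate forbids restating landed declarations) — the next part uses it from the 9227 `VComm2`;
  imports: our `…TransportVComm2A` (hence parts 1, 2, 3, `Vinv`, `Attach1`, `Attach2`, `VComm1`);
  the `open … hiding …` line is the extended one of our `…TransportVComm1`;
* the anchor at the end (explicit-`∀` form of `VinvStep_Istep_side`, registered sub-goal) is new.
-/

noncomputable section

namespace Summit.AtomisticToContinuum.Crystallization.Theorems.HullExactificationCascadeRobustBarlowTemplate

open Literature.Geometry.DiscreteGeometry Literature.MathematicalPhysics.StatisticalMechanics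
open Summit.AtomisticToContinuum.Crystallization.Theorems.PalmUnimodularRigidityShellsToBarlowChart hiding
  IsZChart TransportSystem scales_tied sqNormInt_transfer bond_symm nb_mem zlab_spec zlab_nb bond_nb_iff
  pattern_cases transfer_nb_nb transfer_nb_centre transfer_nb_target sqNormInt_zlab_centre hcp_of_mirror_pair
  Istep_spec Jstep_spec IinvStep_spec JinvStep_spec capWithAny_of_mem_cap IinvStep_Istep Istep_IinvStep
  JinvStep_Jstep Jstep_JinvStep polar_at_apex onesided_at_apex nb_inj Istep_lower Jstep_lower
  IinvStep_lower JinvStep_lower Vstep_spec polar_at_lower_apex onesided_at_lower_apex VinvStep_spec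
  attach_I_even attach_I_odd attach_lower_I_pos attach_lower_I_neg attach_J_even attach_J_odd
  Vstep_Istep_pt Vstep_Istep_back Vstep_Istep_side Vstep_Jstep_pt

variable {S : Set (EuclideanSpace ℝ (Fin 3))} {Pc : (EuclideanSpace ℝ (Fin 3)) → Finset (Fin 3 → ℤ)}
  {Ac : (EuclideanSpace ℝ (Fin 3)) → ((EuclideanSpace ℝ (Fin 3)) →ₗᵢ[ℝ] (EuclideanSpace ℝ (Fin 3)))} {nb : (EuclideanSpace ℝ (Fin 3)) → (Fin 3 → ℤ) → (EuclideanSpace ℝ (Fin 3))}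

/-- **`V⁻¹ ∘ I`, the second direction.**  With `d₁ = (V⁻¹ (I g)).pt` and `dJ = (V⁻¹ (J g)).pt`,
the label of `dJ` at `d₁` is `(V⁻¹ (I g)).t₂ − (V⁻¹ (I g)).t₁`. [folklore] -/
theorem VinvStep_Istep_side (hch : ∀ z ∈ S, IsZChart S z (Pc z) (Ac z) (nb z))
    (hsy : ∀ x ∈ S, ∀ y ∈ shell S x, x ∈ shell S y) {x : (EuclideanSpace ℝ (Fin 3))}
    (hx : x ∈ S) {t₁ t₂ : Fin 3 → ℤ} {U : Finset (Fin 3 → ℤ)} (hU : IsFrame (Pc x) t₁ t₂ U)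
    (hI : IsFrame (Pc (nb x t₁)) (Istep Pc nb ⟨x, t₁, t₂, U⟩).t₁ (Istep Pc nb ⟨x, t₁, t₂, U⟩).t₂
      (Istep Pc nb ⟨x, t₁, t₂, U⟩).U)
    (hJ : IsFrame (Pc (nb x t₂)) (Jstep Pc nb ⟨x, t₁, t₂, U⟩).t₁ (Jstep Pc nb ⟨x, t₁, t₂, U⟩).t₂
      (Jstep Pc nb ⟨x, t₁, t₂, U⟩).U)
    (hIi : IsFrame (Pc (nb x (-t₁))) (IinvStep Pc nb ⟨x, t₁, t₂, U⟩).t₁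
      (IinvStep Pc nb ⟨x, t₁, t₂, U⟩).t₂ (IinvStep Pc nb ⟨x, t₁, t₂, U⟩).U)
    (hJi : IsFrame (Pc (nb x (-t₂))) (JinvStep Pc nb ⟨x, t₁, t₂, U⟩).t₁
      (JinvStep Pc nb ⟨x, t₁, t₂, U⟩).t₂ (JinvStep Pc nb ⟨x, t₁, t₂, U⟩).U)
    (hII : IsFrame (Pc (nb (nb x t₁) (Istep Pc nb ⟨x, t₁, t₂, U⟩).t₁))
      (Istep Pc nb (Istep Pc nb ⟨x, t₁, t₂, U⟩)).t₁ (Istep Pc nb (Istep Pc nb ⟨x, t₁, t₂, U⟩)).t₂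
      (Istep Pc nb (Istep Pc nb ⟨x, t₁, t₂, U⟩)).U)
    (hJI : IsFrame (Pc (nb (nb x t₁) (Istep Pc nb ⟨x, t₁, t₂, U⟩).t₂))
      (Jstep Pc nb (Istep Pc nb ⟨x, t₁, t₂, U⟩)).t₁ (Jstep Pc nb (Istep Pc nb ⟨x, t₁, t₂, U⟩)).t₂
      (Jstep Pc nb (Istep Pc nb ⟨x, t₁, t₂, U⟩)).U)
    (hIiI : IsFrame (Pc (nb (nb x t₁) (-(Istep Pc nb ⟨x, t₁, t₂, U⟩).t₁)))
      (IinvStep Pc nb (Istep Pc nb ⟨x, t₁, t₂, U⟩)).t₁ (IinvStep Pc nb (Istep Pc nb ⟨x, t₁, t₂, U⟩)).t₂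
      (IinvStep Pc nb (Istep Pc nb ⟨x, t₁, t₂, U⟩)).U)
    (hJiI : IsFrame (Pc (nb (nb x t₁) (-(Istep Pc nb ⟨x, t₁, t₂, U⟩).t₂)))
      (JinvStep Pc nb (Istep Pc nb ⟨x, t₁, t₂, U⟩)).t₁ (JinvStep Pc nb (Istep Pc nb ⟨x, t₁, t₂, U⟩)).t₂
      (JinvStep Pc nb (Istep Pc nb ⟨x, t₁, t₂, U⟩)).U)
    (hcomm : Istep Pc nb (Jstep Pc nb ⟨x, t₁, t₂, U⟩) = Jstep Pc nb (Istep Pc nb ⟨x, t₁, t₂, U⟩)) :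
    zlab Pc nb (VinvStep Pc nb (Istep Pc nb ⟨x, t₁, t₂, U⟩)).pt (VinvStep Pc nb (Jstep Pc nb ⟨x, t₁, t₂, U⟩)).pt =
        (VinvStep Pc nb (Istep Pc nb ⟨x, t₁, t₂, U⟩)).t₂ - (VinvStep Pc nb (Istep Pc nb ⟨x, t₁, t₂, U⟩)).t₁ ∧
      (VinvStep Pc nb (Jstep Pc nb ⟨x, t₁, t₂, U⟩)).pt ∈ shell S (VinvStep Pc nb (Istep Pc nb ⟨x, t₁, t₂, U⟩)).pt := by
  have hregI := hregI_of_valid (Pc := Pc) (nb := nb) hI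
  have hregJ := hregJ_of_valid (Pc := Pc) (nb := nb) hJ
  obtain ⟨hyS, hbxy, hwP, hwx, hvP, hvnb, -, -, -, hκ, -, hframe, hparI, -⟩ := Istep_spec hch hsy hx hU hregI
  obtain ⟨hyJS, -, -, -, -, -, -, -, -, -, -, hJframe, hparJ, -⟩ := Jstep_spec hch hsy hx hU hregJ
  obtain ⟨hd'L, hdS, hbd, hξP, hξx, hframeVi, -, hbr⟩ := VinvStep_spec hch hsy hx hU hI hJ hIi hJi
  have hPx := pattern_cases hch hx
  have hPy := pattern_cases hch hyS
  obtain ⟨h12, hhex, hUP, -, -⟩ := id hU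
  have ht₁ : t₁ ∈ Pc x := hhex (mem_hexLabels_iff.2 (Or.inl rfl))
  have ht₂ : t₂ ∈ Pc x := hhex (mem_hexLabels_iff.2 (Or.inr (Or.inl rfl)))
  have ht12 : t₁ - t₂ ∈ Pc x :=
    hhex (mem_hexLabels_iff.2 (Or.inr (Or.inr (Or.inr (Or.inr (Or.inr rfl))))))
  set d' := apexOf t₁ t₂ (lowerCap (Pc x) t₁ t₂ U) with hd'_def
  have hd'P : d' ∈ Pc x := (mem_lowerCap_iff.1 hd'L).1
  have hd'hex : d' ∉ hexLabels t₁ t₂ := (mem_lowerCap_iff.1 hd'L).2.1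
  -- frames `I g`, `J g`
  set a' := (Istep Pc nb ⟨x, t₁, t₂, U⟩).t₁ with ha'
  set b' := (Istep Pc nb ⟨x, t₁, t₂, U⟩).t₂ with hb'
  set U' := (Istep Pc nb ⟨x, t₁, t₂, U⟩).U with hU'
  have hIeq : Istep Pc nb ⟨x, t₁, t₂, U⟩ = ⟨nb x t₁, a', b', U'⟩ := rfl
  set aJ := (Jstep Pc nb ⟨x, t₁, t₂, U⟩).t₁ with haJ
  set bJ := (Jstep Pc nb ⟨x, t₁, t₂, U⟩).t₂ with hbJ_def
  set UJ := (Jstep Pc nb ⟨x, t₁, t₂, U⟩).U with hUJ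
  have hJeq : Jstep Pc nb ⟨x, t₁, t₂, U⟩ = ⟨nb x t₂, aJ, bJ, UJ⟩ := rfl
  rw [hIeq] at hII hJI hIiI hJiI hcomm ⊢
  rw [hJeq] at hcomm ⊢
  obtain ⟨hdL'L, hd₁S, hbyd₁, hξ'P, hξ'y, hframeVi', -, hbr'⟩ :=
    VinvStep_spec hch hsy hyS hframe hII hJI hIiI hJiI
  obtain ⟨h12', hhex', hUP', -, -⟩ := id hframe
  have ha'P : a' ∈ Pc (nb x t₁) := hhex' (mem_hexLabels_iff.2 (Or.inl rfl))
  have hb'P : b' ∈ Pc (nb x t₁) := hhex' (mem_hexLabels_iff.2 (Or.inr (Or.inl rfl)))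
  set dL' := apexOf a' b' (lowerCap (Pc (nb x t₁)) a' b' U') with hdL'_def
  have hdL'P : dL' ∈ Pc (nb x t₁) := (mem_lowerCap_iff.1 hdL'L).1
  have hV'pt : (VinvStep Pc nb ⟨nb x t₁, a', b', U'⟩).pt = nb (nb x t₁) dL' := rfl
  rw [hV'pt] at *
  set d₁ := nb (nb x t₁) dL' with hd₁_def
  set τ₁'' := (VinvStep Pc nb ⟨nb x t₁, a', b', U'⟩).t₁ with hτ₁''_def
  set τ₂'' := (VinvStep Pc nb ⟨nb x t₁, a', b', U'⟩).t₂ with hτ₂''_def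
  have hPd₁ := pattern_cases hch hd₁S
  obtain ⟨h12'', hhex'', -, -, -⟩ := id hframeVi'
  have hτ21P : τ₂'' - τ₁'' ∈ Pc d₁ := hhex'' (mem_hexLabels_iff.2 (Or.inr (Or.inr (Or.inl rfl))))
  have Dτ12 : sqNormInt (τ₁'' - τ₂'') = 18 := h12''
  -- the point `dJ = (V⁻¹ (J g)).pt`
  set dJ' := apexOf aJ bJ (lowerCap (Pc (nb x t₂)) aJ bJ UJ) with hdJ'_def
  have hVJpt : (VinvStep Pc nb ⟨nb x t₂, aJ, bJ, UJ⟩).pt = nb (nb x t₂) dJ' := rfl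
  rw [hVJpt]
  rcases hbr with ⟨hlp, -, -, -, -⟩ | ⟨hlp, -, -, -, -⟩
  · /- letter below `+1`: everything is read in the chart of `x` -/
    rcases hbr' with ⟨-, hUd₁, hnI', hnJ', -⟩ | ⟨hlp'', -, -, -, -⟩
    swap
    · obtain ⟨hlp', -, -⟩ := attach_lower_I_pos hch hsy hx hU hlp hregI
      rw [hIeq] at hlp'
      exact absurd (hlp'.symm.trans hlp'') (by norm_num)
    obtain ⟨-, -, -, hd1, hd2, hLeq⟩ := pos_form_of_lowerParity hPx hU hlp
    obtain ⟨-, hattI, -⟩ := attach_lower_I_pos hch hsy hx hU hlp hregI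
    obtain ⟨-, hattJ, -⟩ := attach_lower_J_pos hch hsy hx hU hlp hregJ
    rw [hIeq] at hattI
    rw [hJeq] at hattJ
    have hd₁x : nb x (d' + t₁) = d₁ := hattI.symm
    have hdJx : nb (nb x t₂) dJ' = nb x (d' + t₂) := hattJ
    rw [hdJx]
    have hyx : nb (nb x t₁) (-a') = x := by
      show nb (nb x t₁) (-(-zlab Pc nb (nb x t₁) x)) = x
      rw [neg_neg]; exact hwx
    have hyz : nb (nb x t₁) (-b') = nb x (t₁ - t₂) := by
      have e : -b' = zlab Pc nb (nb x t₁) (nb x (t₁ - t₂)) := by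
        rw [hκ]
        show -(zlab Pc nb (nb x t₁) (nb x t₂) - zlab Pc nb (nb x t₁) x) = _
        abel
      rw [e]
      exact (zlab_spec hch hyS (nb_mem hch hx ht12).1 ((bond_nb_iff hch hx ht₁ ht12).2
        (dist_hexagon (Pc x) hPx t₁ ht₁ t₂ ht₂ h12 hhex).2.2.2.2.2.1)).2
    have hη'P : zlab Pc nb d₁ (nb x t₁) - τ₁'' ∈ Pc d₁ := hframeVi'.2.2.1 (by rw [hUd₁]; simp)
    have hζ'P : zlab Pc nb d₁ (nb x t₁) - τ₂'' ∈ Pc d₁ := hframeVi'.2.2.1 (by rw [hUd₁]; simp)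
    have hη' : zlab Pc nb d₁ x = zlab Pc nb d₁ (nb x t₁) - τ₁'' := by
      have h : zlab Pc nb d₁ (nb (nb x t₁) (-a')) = zlab Pc nb d₁ (nb x t₁) - τ₁'' := by
        rw [← hnI']; exact zlab_nb hch hd₁S hη'P
      rwa [hyx] at h
    have hζ' : zlab Pc nb d₁ (nb x (t₁ - t₂)) = zlab Pc nb d₁ (nb x t₁) - τ₂'' := by
      have h : zlab Pc nb d₁ (nb (nb x t₁) (-b')) = zlab Pc nb d₁ (nb x t₁) - τ₂'' := by
        rw [← hnJ']; exact zlab_nb hch hd₁S hζ'P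
      rwa [hyz] at h
    have hbxd₁ : d₁ ∈ shell S x := by
      rw [← hd₁x]; exact (nb_mem hch hx hd1).2
    have hbd₁dJ : nb x (d' + t₂) ∈ shell S d₁ := by
      have := (bond_nb_iff hch hx hd1 hd2).2 (by
        rw [show d' + t₁ - (d' + t₂) = t₁ - t₂ by abel]; exact h12)
      rwa [hd₁x] at this
    have hbd₁z : nb x (t₁ - t₂) ∈ shell S d₁ := by
      have h : nb (nb x t₁) (-b') ∈ shell S d₁ := by
        rw [← hnJ']; exact (nb_mem hch hd₁S hζ'P).2
      rwa [hyz] at h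
    have hdJS : nb x (d' + t₂) ∈ S := (nb_mem hch hx hd2).1
    have hβ := zlab_spec hch hd₁S hdJS hbd₁dJ
    have Dβη : sqNormInt (zlab Pc nb d₁ (nb x (d' + t₂)) - zlab Pc nb d₁ x) = 18 := by
      rw [transfer_nb_centre hch hsy hx hd₁S hbxd₁ hd2 hbd₁dJ]; exact zchart_sqNormInt_eq (hch x hx) hd2
    have Dβζ : sqNormInt (zlab Pc nb d₁ (nb x (d' + t₂)) - zlab Pc nb d₁ (nb x (t₁ - t₂))) = 54 := by
      rw [transfer_nb_nb hch hsy hx hd₁S hbxd₁ hd2 ht12 hbd₁dJ hbd₁z]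
      exact (dist_oddCap_cb (Pc x) hPx t₁ ht₁ t₂ ht₂ d' hd'P h12 hhex hd'hex hd1 hd2).2.2.2.2.2
    have hβeq : zlab Pc nb d₁ (nb x (d' + t₂)) = τ₂'' - τ₁'' := by
      have h := label_third_vertex (Pc d₁) hPd₁ (zlab Pc nb d₁ (nb x t₁) - τ₂'') hζ'P
        (zlab Pc nb d₁ (nb x t₁) - τ₁'') hη'P _ hβ.1
        (by rw [show zlab Pc nb d₁ (nb x t₁) - τ₂'' - (zlab Pc nb d₁ (nb x t₁) - τ₁'') = τ₁'' - τ₂'' by abel]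
            exact Dτ12)
        (by rw [← hη']; exact Dβη) (by rw [← hζ']; exact Dβζ)
        (by rw [show zlab Pc nb d₁ (nb x t₁) - τ₁'' - (zlab Pc nb d₁ (nb x t₁) - τ₂'') = τ₂'' - τ₁'' by abel]
            exact hτ21P)
      rw [h]; abel
    exact ⟨hβeq, hbd₁dJ⟩
  · /- letter below `−1`: everything is read in the chart of `x'' = JIx = nb y b'` -/
    obtain ⟨hlp', hattJI, hlabJI⟩ := attach_lower_I_neg hch hsy hx hU hlp hregI
    rw [hIeq] at hlp' hattJI hlabJI
    rcases hbr' with ⟨hlp'', -, -, -, -⟩ | ⟨-, hUd₁, hnI', hnJ', -⟩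
    · rw [hlp'] at hlp''; norm_num at hlp''
    -- the frame `J (I g) = ⟨x'', a'', b'', U''⟩` and its lower cap
    set a'' := (Jstep Pc nb ⟨nb x t₁, a', b', U'⟩).t₁ with ha''
    set b'' := (Jstep Pc nb ⟨nb x t₁, a', b', U'⟩).t₂ with hb''
    set U'' := (Jstep Pc nb ⟨nb x t₁, a', b', U'⟩).U with hU''
    have hJIeq : Jstep Pc nb ⟨nb x t₁, a', b', U'⟩ = ⟨nb (nb x t₁) b', a'', b'', U''⟩ := rfl
    have hregJI := hregJ_of_valid (Pc := Pc) (nb := nb) hJI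
    obtain ⟨hx''S, hbyx'', hw''P, hw''y, hv''P, hv''nb, -, -, -, -, -, hframe'', -, -⟩ :=
      Jstep_spec hch hsy hyS hframe hregJI
    have hPx'' := pattern_cases hch hx''S
    obtain ⟨h12x, hhexx, -, -, -⟩ := id hframe''
    have ha''P : a'' ∈ Pc (nb (nb x t₁) b') := hhexx (mem_hexLabels_iff.2 (Or.inl rfl))
    have hb''P : b'' ∈ Pc (nb (nb x t₁) b') := hhexx (mem_hexLabels_iff.2 (Or.inr (Or.inl rfl)))
    have hab''P : a'' - b'' ∈ Pc (nb (nb x t₁) b') :=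
      hhexx (mem_hexLabels_iff.2 (Or.inr (Or.inr (Or.inr (Or.inr (Or.inr rfl))))))
    -- `d₁ = nb x'' (dL'' − b'')` by the lower J-attachment at `I g`
    obtain ⟨hlpJI, hattJ, -⟩ := attach_lower_J_neg hch hsy hyS hframe hlp' hregJI
    rw [hJIeq] at hlpJI hattJ
    obtain ⟨hdL''L, hdL''P, hdL''hex, hd1'', hd2'', hL''eq⟩ := neg_form_of_lowerParity hPx'' hframe'' hlpJI
    set dL'' := apexOf a'' b'' (lowerCap (Pc (nb (nb x t₁) b')) a'' b'' U'') with hdL''_def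
    have hd₁x'' : nb (nb (nb x t₁) b') (dL'' - b'') = d₁ := hattJ
    -- `dJ = nb x'' (dL'' − a'')` by the lower I-attachment at `J g` through the in-layer commutation
    obtain ⟨hlpJ, -, -⟩ := attach_lower_J_neg hch hsy hx hU hlp hregJ
    rw [hJeq] at hlpJ
    have hpteq : nb (nb x t₂) aJ = nb (nb x t₁) b' := congrArg ZFrame.pt hcomm
    have hregIJ : Pc (nb (nb x t₂) aJ) = fcc3Int ∨ Pc (nb x t₂) = hcpInt ∨
        (-zlab Pc nb (nb (nb x t₂) aJ) (nb x t₂) ∈ Pc (nb (nb x t₂) aJ) ∧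
          -zlab Pc nb (nb (nb x t₂) aJ) (nb (nb x t₂) bJ) ∈ Pc (nb (nb x t₂) aJ)) := by
      apply hregI_of_valid (Pc := Pc) (nb := nb)
      rw [hcomm, hpteq]; exact hJI
    obtain ⟨-, hattI, -⟩ := attach_lower_I_neg hch hsy hyJS hJframe hlpJ hregIJ
    rw [hcomm] at hattI
    rw [hpteq] at hattI
    have hdJx'' : nb (nb (nb x t₁) b') (dL'' - a'') = nb (nb x t₂) dJ' := hattI
    -- bonds at `x''`
    have hbd₁dJ : nb (nb x t₂) dJ' ∈ shell S d₁ := by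
      have := (bond_nb_iff hch hx''S hd2'' hd1'').2 (by
        rw [show dL'' - b'' - (dL'' - a'') = a'' - b'' by abel]; exact h12x)
      rwa [hd₁x'', hdJx''] at this
    have hbx''d₁ : d₁ ∈ shell S (nb (nb x t₁) b') := by
      rw [← hd₁x'']; exact (nb_mem hch hx''S hd2'').2
    have hdJS : nb (nb x t₂) dJ' ∈ S := by rw [← hdJx'']; exact (nb_mem hch hx''S hd1'').1
    have hβ := zlab_spec hch hd₁S hdJS hbd₁dJ
    -- `ζ' = ξ' + τ₂''` labels `x''`, `η' = ξ' + τ₁''` labels `IIx = nb x'' (a'' − b'')`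
    have hζ'P : zlab Pc nb d₁ (nb x t₁) + τ₂'' ∈ Pc d₁ := hframeVi'.2.2.1 (by rw [hUd₁]; simp)
    have hη'P : zlab Pc nb d₁ (nb x t₁) + τ₁'' ∈ Pc d₁ := hframeVi'.2.2.1 (by rw [hUd₁]; simp)
    have hζ' : zlab Pc nb d₁ (nb (nb x t₁) b') = zlab Pc nb d₁ (nb x t₁) + τ₂'' := by
      rw [← hnJ']; exact zlab_nb hch hd₁S hζ'P
    have hη' : zlab Pc nb d₁ (nb (nb x t₁) a') = zlab Pc nb d₁ (nb x t₁) + τ₁'' := by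
      rw [← hnI']; exact zlab_nb hch hd₁S hη'P
    have hbd₁II : nb (nb x t₁) a' ∈ shell S d₁ := by
      rw [← hnI']; exact (nb_mem hch hd₁S hη'P).2
    have hIIx'' : nb (nb (nb x t₁) b') (a'' - b'') = nb (nb x t₁) a' := by
      have e : a'' - b'' = zlab Pc nb (nb (nb x t₁) b') (nb (nb x t₁) a') := by
        show (zlab Pc nb (nb (nb x t₁) b') (nb (nb x t₁) a') - zlab Pc nb (nb (nb x t₁) b') (nb x t₁)) -
          -zlab Pc nb (nb (nb x t₁) b') (nb x t₁) = _
        abel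
      rw [e]; exact hv''nb
    have Dβζ : sqNormInt (zlab Pc nb d₁ (nb (nb x t₂) dJ') - zlab Pc nb d₁ (nb (nb x t₁) b')) = 18 := by
      have h := transfer_nb_centre hch hsy hx''S hd₁S hbx''d₁ hd1'' (by rw [hdJx'']; exact hbd₁dJ)
      rw [hdJx''] at h
      rw [h]; exact zchart_sqNormInt_eq (hch _ hx''S) hd1''
    have Dβη : sqNormInt (zlab Pc nb d₁ (nb (nb x t₂) dJ') - zlab Pc nb d₁ (nb (nb x t₁) a')) = 54 := by
      have h := transfer_nb_nb hch hsy hx''S hd₁S hbx''d₁ hd1'' hab''P (by rw [hdJx'']; exact hbd₁dJ)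
        (by rw [hIIx'']; exact hbd₁II)
      rw [hdJx'', hIIx''] at h
      rw [h]
      exact (dist_evenCap_ca (Pc (nb (nb x t₁) b')) hPx'' a'' ha''P b'' hb''P dL'' hdL''P h12x hhexx
        hdL''hex hd1'' hd2'').2.2.2.2.2
    have hβeq : zlab Pc nb d₁ (nb (nb x t₂) dJ') = τ₂'' - τ₁'' := by
      have h := label_third_vertex (Pc d₁) hPd₁ (zlab Pc nb d₁ (nb x t₁) + τ₁'') hη'P
        (zlab Pc nb d₁ (nb x t₁) + τ₂'') hζ'P _ hβ.1
        (by rw [show zlab Pc nb d₁ (nb x t₁) + τ₁'' - (zlab Pc nb d₁ (nb x t₁) + τ₂'') = τ₁'' - τ₂'' by abel]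
            exact Dτ12)
        (by rw [← hζ']; exact Dβζ) (by rw [← hη']; exact Dβη)
        (by rw [show zlab Pc nb d₁ (nb x t₁) + τ₂'' - (zlab Pc nb d₁ (nb x t₁) + τ₁'') = τ₂'' - τ₁'' by abel]
            exact hτ21P)
      rw [h]; abel
    exact ⟨hβeq, hbd₁dJ⟩

/-! ## Anchor -/

/-- Anchor (registered sub-goal of stmt-AtomisticToContinuum-12088, toward `develop_transport`):
`V⁻¹ ∘ I`, the second direction (explicit form of `VinvStep_Istep_side`): if `I` and `J` commute
at `g`, the label of `(V⁻¹ (J g)).pt` at `(V⁻¹ (I g)).pt` is `(V⁻¹ (I g)).t₂ − (V⁻¹ (I g)).t₁`,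
a shell point. [folklore] -/
theorem transportVComm2_anchor : ∀ (S : Set (EuclideanSpace ℝ (Fin 3))) (Pc : EuclideanSpace ℝ (Fin 3) → Finset (Fin 3 → ℤ)) (Ac : EuclideanSpace ℝ (Fin 3) → (EuclideanSpace ℝ (Fin 3) →ₗᵢ[ℝ] EuclideanSpace ℝ (Fin 3))) (nb : EuclideanSpace ℝ (Fin 3) → (Fin 3 → ℤ) → EuclideanSpace ℝ (Fin 3)), (∀ z ∈ S, IsZChart S z (Pc z) (Ac z) (nb z)) → (∀ x ∈ S, ∀ y ∈ shell S x, x ∈ shell S y) → ∀ x ∈ S, ∀ (t₁ t₂ : Fin 3 → ℤ) (U : Finset (Fin 3 → ℤ)), IsFrame (Pc x) t₁ t₂ U → IsFrame (Pc (nb x t₁)) (Istep Pc nb ⟨x, t₁, t₂, U⟩).t₁ (Istep Pc nb ⟨x, t₁, t₂, U⟩).t₂ (Istep Pc nb ⟨x, t₁, t₂, U⟩).U → IsFrame (Pc (nb x t₂)) (Jstep Pc nb ⟨x, t₁, t₂, U⟩).t₁ (Jstep Pc nb ⟨x, t₁, t₂, U⟩).t₂ (Jstep Pc nb ⟨x,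 t₁, t₂, U⟩).U → IsFrame (Pc (nb x (-t₁))) (IinvStep Pc nb ⟨x, t₁, t₂, U⟩).t₁ (IinvStep Pc nb ⟨x, t₁, t₂, U⟩).t₂ (IinvStep Pc nb ⟨x, t₁, t₂, U⟩).U → IsFrame (Pc (nb x (-t₂))) (JinvStep Pc nb ⟨x, t₁, t₂, U⟩).t₁ (JinvStep Pc nb ⟨x, t₁, t₂, U⟩).t₂ (JinvStep Pc nb ⟨x, t₁, t₂, U⟩).U → IsFrame (Pc (nb (nb x t₁) (Istep Pc nb ⟨x, t₁, t₂, U⟩).t₁)) (Istep Pc nb (Istep Pc nb ⟨x, t₁, t₂, U⟩)).t₁ (Istep Pc nb (Istep Pc nb ⟨x, t₁, t₂, U⟩)).t₂ (Istep Pc nb (Istep Pc nb ⟨x, t₁, t₂, U⟩)).U → IsFrame (Pc (nb (nb x t₁) (Istep Pc nb ⟨x, t₁, t₂, U⟩).t₂)) (Jstep Pc nb (Istep Pc nb ⟨x, t₁, t₂, U⟩)).t₁ (Jstep Pc nb (Istep Pc nb ⟨x, t₁, t₂, U⟩)).t₂ (Jstep Pc nb (Istep Pc nb ⟨x, t₁,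 t₂, U⟩)).U → IsFrame (Pc (nb (nb x t₁) (-(Istep Pc nb ⟨x, t₁, t₂, U⟩).t₁))) (IinvStep Pc nb (Istep Pc nb ⟨x, t₁, t₂, U⟩)).t₁ (IinvStep Pc nb (Istep Pc nb ⟨x, t₁, t₂, U⟩)).t₂ (IinvStep Pc nb (Istep Pc nb ⟨x, t₁, t₂, U⟩)).U → IsFrame (Pc (nb (nb x t₁) (-(Istep Pc nb ⟨x, t₁, t₂, U⟩).t₂))) (JinvStep Pc nb (Istep Pc nb ⟨x, t₁, t₂, U⟩)).t₁ (JinvStep Pc nb (Istep Pc nb ⟨x, t₁, t₂, U⟩)).t₂ (JinvStep Pc nb (Istep Pc nb ⟨x, t₁, t₂, U⟩)).U → Istep Pc nb (Jstep Pc nb ⟨x, t₁, t₂, U⟩) = Jstep Pc nb (Istep Pc nb ⟨x, t₁, t₂, U⟩) → zlab Pc nb (VinvStep Pc nb (Istep Pc nb ⟨x, t₁, t₂, U⟩)).pt (VinvStep Pc nb (Jstep Pc nb ⟨x, t₁, t₂, U⟩)).pt = (VinvStep Pc nb (Istep Pc nb ⟨x, t₁, t₂, U⟩)).t₂ - (VinvStep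 Pc nb (Istep Pc nb ⟨x, t₁, t₂, U⟩)).t₁ ∧ (VinvStep Pc nb (Jstep Pc nb ⟨x, t₁, t₂, U⟩)).pt ∈ shell S (VinvStep Pc nb (Istep Pc nb ⟨x, t₁, t₂, U⟩)).pt :=
  fun _ _ _ _ hch hsy _ hx _ _ _ hU hI hJ hIi hJi hII hJI hIiI hJiI hcomm =>
    VinvStep_Istep_side hch hsy hx hU hI hJ hIi hJi hII hJI hIiI hJiI hcomm

end Summit.AtomisticToContinuum.Crystallization.Theorems.HullExactificationCascadeRobustBarlowTemplate

end
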